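import Summits.QuantumFields.YangMills.Theorems.BalabanLadderUVSeamRecCeilingsPolymerRarityMoments
import HarnessLib

/-!
# Crux `UVSeamRec` (stmt-QuantumFields-20043), stub `stub_ceilings` (E0′): suppliers of the RP-free rarity —
# compatible polymer families, the SCALE-FACTORISED MOMENT currency (Track A node N20's (SF) shape), threshold calibration

Helper file (`--supports stmt-QuantumFields-20043`) of the width-lever seat `ym-20043-ceilings-p2` (lane B); sequel of
`…CeilingsPolymerRarity.lean` (p527372: Chebyshev + polymer-gas domination) and `…CeilingsPolymerRarityMoments.lean`
(p528131: `MomentBounds6 G r a` on ALL odd sides from a tempered centre law + (EM)/(PL)).  HONEST FRAMING: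
consumption-side theorems for OPEN hypotheses; nothing of E0′ or of Bałaban's estimates is asserted; not a gap, not Clay.

* §1 `productLaw_of_compatible` — the Peierls product law need only be ASSUMED for pairwise-compatible sub-families once
  incompatible polymers never co-occur (as in every genuine polymer representation: the occurring polymers are the
  connected components of the large-field region); for the other sub-families the intersection is empty.
* §2 THE MOMENT CURRENCY — `integral_exp_mul_sum_influence_le_of_scaleFactorised` /
  `measureReal_biInter_le_pow_of_scaleFactorised`: if the influence functionals are dominated by nonnegative
  combinations `Σ_π a_{iπ} ψ_π` of finitely many bounded measurable «carrier» fields `ψ_π` (read: `β(1 − Re tr Ū^k(∂p))`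
  for the block-averaged plaquettes `p` of every level `k` near the cube) whose joint exponential moments are
  SCALE-FACTORISED, `∫ exp(Σ_π t_π ψ_π) dμ ≤ exp(c_V Σ_π t_π)` for all tilts `0 ≤ t_π ≤ a₀` — the shape of hypothesis (SF)
  of Track A's node N20 (`BalabanUVNodesN20ByValueMultiscaleWall`, there on Bałaban's even family tori) — then
  `∫ exp(λ Σ_{i∈T} I_i) dμ ≤ exp(c_V λ W · #T)` (`λΛ ≤ a₀`, `Σ_i a_{iπ} ≤ Λ`, `Σ_π a_{iπ} ≤ W`) and the bad cubes are
  multiplicatively rare at rate `exp(c_V λ W − λθ)`: a second supplier of (EM), with no polymer structure at all.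
* §3 `rarity_of_scaleFactorised`, **`momentBounds6_of_temperedLaw_and_scaleFactorised`** — the route corollary on every
  odd torus: tempered centre law + (SF)-type bound of the Wilson state on odd tori ⇒ `MomentBounds6 G r a`.
* §4 `exp_sub_le_div_pow_four` — calibration of the threshold: `B + 4 log R − log C₂ ≤ λθ ⇒ exp(B − λθ) ≤ C₂/R⁴`
  (the numeric side condition of p528131's theorems; with `R ≤ ℓ₁/a(β) ≍ e^{β/(4b₀)}` it asks `λθ ≳ β/b₀`).

References: R. Kotecký, D. Preiss, Commun. Math. Phys. 103 (1986) 491–498 (compatible families); T. Bałaban, Commun.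
Math. Phys. 122 (1989) 355–392, (1.79)–(1.89) (the kind of the (SF)/(PL) inputs); seam-s2 note
`CEILINGS-KERNEL-ANALYSIS-seam-s2.md` rev 4 §9 (N20's (SF) as a supplier of multiplicative rarity).
-/

set_option autoImplicit false

noncomputable section

open MeasureTheory Filter Topology Finset
open Literature.Probability.LatticeModels
open Literature.MathematicalPhysics.QuantumFieldTheory (GaugeConfig wilsonMeasure isProbabilityMeasure_wilsonMeasure
  measurable_torusLift LatticeRep)
open Literature.MathematicalPhysics.QuantumLattice
open Summit.QuantumFields.YangMills.Cruxes.UVSeamRec.DefectCollar (integral_prod_indicator_eq_measureReal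
  momentBounds6_of_goodLaw_and_rarity)

namespace Summit.QuantumFields.YangMills.Cruxes.UVSeamRec.PolymerRarity

/-! ## §1 Compatible families suffice for the product law -/

section Compatible

variable {Ω : Type*} [MeasurableSpace Ω] (μ : Measure Ω) {κ : Type*}

/-- **The product law from its compatible-family form.**  If incompatible distinct polymers never co-occur
(`E_γ ∩ E_{γ'} = ∅`) and the Peierls product law `μ(⋂_{γ∈A} E_γ) ≤ ∏_{γ∈A} w_γ` holds for every pairwise-compatible
sub-family `A ⊆ S` (weights `w ≥ 0`), then it holds for EVERY sub-family `A ⊆ S` — the form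
`PolymerRarity.integral_exp_sum_indicator_le_prod` consumes. [folklore; Kotecký–Preiss setting] -/
theorem productLaw_of_compatible (S : Finset κ) (E : κ → Set Ω) (w : κ → ℝ) (hw : ∀ γ ∈ S, 0 ≤ w γ)
    (compat : κ → κ → Prop)
    (hexcl : ∀ γ ∈ S, ∀ γ' ∈ S, γ ≠ γ' → ¬ compat γ γ' → E γ ∩ E γ' = ∅)
    (hPLc : ∀ A, A ⊆ S → (∀ γ ∈ A, ∀ γ' ∈ A, γ ≠ γ' → compat γ γ') →
      μ.real (⋂ γ ∈ A, E γ) ≤ ∏ γ ∈ A, w γ) :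
    ∀ A, A ⊆ S → μ.real (⋂ γ ∈ A, E γ) ≤ ∏ γ ∈ A, w γ := by
  intro A hA
  by_cases hc : ∀ γ ∈ A, ∀ γ' ∈ A, γ ≠ γ' → compat γ γ'
  · exact hPLc A hA hc
  · simp only [not_forall, exists_prop] at hc
    obtain ⟨γ, hγ, γ', hγ', hne, hnc⟩ := hc
    have hempty : (⋂ δ ∈ A, E δ) = ∅ := by
      apply Set.eq_empty_of_subset_empty
      intro ω hω
      have h1 : ω ∈ E γ := Set.mem_iInter₂.1 hω γ hγ
      have h2 : ω ∈ E γ' := Set.mem_iInter₂.1 hω γ' hγ'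
      have h3 : ω ∈ E γ ∩ E γ' := ⟨h1, h2⟩
      rw [hexcl γ (hA hγ) γ' (hA hγ') hne hnc] at h3
      exact h3
    rw [hempty, measureReal_empty]
    exact Finset.prod_nonneg fun δ hδ => hw δ (hA hδ)

end Compatible

/-! ## §2 The moment currency: scale-factorised joint exponential moments of carrier fields (N20's (SF) shape) -/

section ScaleFactorised

variable {Ω : Type*} [MeasurableSpace Ω] (μ : Measure Ω) [IsProbabilityMeasure μ] {κ : Type*}

omit [IsProbabilityMeasure μ] in
/-- **Joint exponential moments of influence functionals from a SCALE-FACTORISED moment bound.**  Carrier fields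
`ψ_π` (`π ∈ P`); influence coefficients `a_{iπ} ≥ 0` with `Σ_{i∈T} a_{iπ} ≤ Λ` and `Σ_{π∈P} a_{iπ} ≤ W`; a tilt `λ ≥ 0`
with `λΛ ≤ a₀`; and (SF): `∫ exp(Σ_π t_π ψ_π) dμ ≤ exp(c_V Σ_π t_π)` for all tilts `0 ≤ t_π ≤ a₀` (`c_V ≥ 0`).  Then
`∫ exp(λ Σ_{i∈T} Σ_π a_{iπ} ψ_π) dμ ≤ exp(c_V λ W · #T)`.  Proof: exchange the sums — the joint tilt is a carrier tilt
with `t_π = λ Σ_{i∈T} a_{iπ} ∈ [0, a₀]`. [folklore] -/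
theorem integral_exp_mul_sum_influence_le_of_scaleFactorised {ι : Type*} (T : Finset ι) (P : Finset κ)
    (ψ : κ → Ω → ℝ) (a : ι → κ → ℝ) (ha : ∀ i ∈ T, ∀ π ∈ P, 0 ≤ a i π) {lam Λ W a₀ cV : ℝ}
    (hlam : 0 ≤ lam) (hlamΛ : lam * Λ ≤ a₀) (hcV : 0 ≤ cV)
    (hΛ : ∀ π ∈ P, ∑ i ∈ T, a i π ≤ Λ) (hW : ∀ i ∈ T, ∑ π ∈ P, a i π ≤ W)
    (hSF : ∀ t : κ → ℝ, (∀ π ∈ P, 0 ≤ t π ∧ t π ≤ a₀) →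
      ∫ ω, Real.exp (∑ π ∈ P, t π * ψ π ω) ∂μ ≤ Real.exp (cV * ∑ π ∈ P, t π)) :
    ∫ ω, Real.exp (lam * ∑ i ∈ T, ∑ π ∈ P, a i π * ψ π ω) ∂μ ≤ Real.exp (cV * lam * W * T.card) := by
  have hswap : ∀ ω, lam * ∑ i ∈ T, ∑ π ∈ P, a i π * ψ π ω =
      ∑ π ∈ P, (lam * ∑ i ∈ T, a i π) * ψ π ω := by
    intro ω
    rw [Finset.sum_comm, Finset.mul_sum]
    refine Finset.sum_congr rfl fun π _ => ?_
    rw [mul_assoc, Finset.sum_mul]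
  simp_rw [hswap]
  have ht : ∀ π ∈ P, 0 ≤ lam * ∑ i ∈ T, a i π ∧ lam * ∑ i ∈ T, a i π ≤ a₀ := fun π hπ =>
    ⟨mul_nonneg hlam (Finset.sum_nonneg fun i hi => ha i hi π hπ),
      (mul_le_mul_of_nonneg_left (hΛ π hπ) hlam).trans hlamΛ⟩
  refine (hSF _ ht).trans (Real.exp_le_exp.2 ?_)
  calc cV * ∑ π ∈ P, lam * ∑ i ∈ T, a i π = cV * lam * ∑ i ∈ T, ∑ π ∈ P, a i π := by
        rw [← Finset.mul_sum, Finset.sum_comm]; ring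
    _ ≤ cV * lam * ∑ _i ∈ T, W :=
        mul_le_mul_of_nonneg_left (Finset.sum_le_sum fun i hi => hW i hi) (mul_nonneg hcV hlam)
    _ = cV * lam * W * T.card := by rw [Finset.sum_const, nsmul_eq_mul]; ring

/-- **MULTIPLICATIVE RARITY FROM THE SCALE-FACTORISED MOMENT BOUND.**  In the setting of
`integral_exp_mul_sum_influence_le_of_scaleFactorised`, with the carriers measurable and bounded (`|ψ_π| ≤ K`), for
every threshold `θ`: `μ(⋂_{i∈T} {θ ≤ Σ_π a_{iπ} ψ_π}) ≤ exp(c_V λ W − λθ)^{#T}` — hypothesis (b) of the defect collar at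
the rate `exp(c_V λ W − λθ)`, from an N20-type bound (SF) alone: no polymers, no reflection positivity, no tiling.
[folklore] -/
theorem measureReal_biInter_le_pow_of_scaleFactorised {ι : Type*} (T : Finset ι) (P : Finset κ)
    (ψ : κ → Ω → ℝ) (hψm : ∀ π, Measurable (ψ π)) {K : ℝ} (hψb : ∀ π ω, |ψ π ω| ≤ K)
    (a : ι → κ → ℝ) (ha : ∀ i ∈ T, ∀ π ∈ P, 0 ≤ a i π) {lam Λ W a₀ cV : ℝ} (θ : ℝ)
    (hlam : 0 ≤ lam) (hlamΛ : lam * Λ ≤ a₀) (hcV : 0 ≤ cV)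
    (hΛ : ∀ π ∈ P, ∑ i ∈ T, a i π ≤ Λ) (hW : ∀ i ∈ T, ∑ π ∈ P, a i π ≤ W)
    (hSF : ∀ t : κ → ℝ, (∀ π ∈ P, 0 ≤ t π ∧ t π ≤ a₀) →
      ∫ ω, Real.exp (∑ π ∈ P, t π * ψ π ω) ∂μ ≤ Real.exp (cV * ∑ π ∈ P, t π)) :
    μ.real (⋂ i ∈ T, {ω | θ ≤ ∑ π ∈ P, a i π * ψ π ω}) ≤ (Real.exp (cV * lam * W - lam * θ)) ^ T.card := by
  have hIm : ∀ i, Measurable fun ω => ∑ π ∈ P, a i π * ψ π ω := fun i =>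
    Finset.measurable_sum P fun π _ => (hψm π).const_mul _
  have hint : Integrable (fun ω => Real.exp (lam * ∑ i ∈ T, ∑ π ∈ P, a i π * ψ π ω)) μ := by
    refine integrable_of_abs_le ((Finset.measurable_sum T fun i _ => hIm i).const_mul lam).exp
      (C := Real.exp (lam * ∑ i ∈ T, ∑ π ∈ P, |a i π| * K)) fun ω => ?_
    rw [Real.abs_exp]
    refine Real.exp_le_exp.2 (mul_le_mul_of_nonneg_left ?_ hlam)
    refine Finset.sum_le_sum fun i _ => Finset.sum_le_sum fun π _ => ?_
    calc a i π * ψ π ω ≤ |a i π * ψ π ω| := le_abs_self _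
      _ = |a i π| * |ψ π ω| := abs_mul _ _
      _ ≤ |a i π| * K := mul_le_mul_of_nonneg_left (hψb π ω) (abs_nonneg _)
  have hmom := integral_exp_mul_sum_influence_le_of_scaleFactorised μ T P ψ a ha hlam hlamΛ hcV hΛ hW hSF
  have key := measureReal_biInter_le_pow_of_expMoment μ T (fun i ω => ∑ π ∈ P, a i π * ψ π ω) hIm θ hlam hint
    (B := cV * lam * W) (by simpa [mul_assoc] using hmom)
  simpa using key

end ScaleFactorised

/-! ## §3 The route corollary: `MomentBounds6` from a tempered centre law and an (SF)-type bound on odd tori -/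

section Route

open Summit.QuantumFields.YangMills.Cruxes.OSLegsFromFemtoAndGap.DlrCollarTransfer

variable {G : Type} [Group G] [TopologicalSpace G] [IsTopologicalGroup G] [CompactSpace G]
  [MeasurableSpace G] [BorelSpace G] (r : LatticeRep G) (a : ℝ → ℝ)

/-- **Multiplicative rarity of the non-tempered cube-exteriors from a SCALE-FACTORISED moment bound of the Wilson
state, on every odd torus.**  Data: a measurable influence functional `I` with threshold `θ`, tilt `λ ≥ 0`, influence
bounds `Λ`, `W`, tilt budget `a₀` with `λΛ ≤ a₀`, volume letter `c_V ≥ 0`, and `exp(c_V λ W − λθ) ≤ C₂/R⁴`; and (SF):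
for `β ≥ β₁`, on every odd torus `(ℤ/(2L+1))⁴` with `4R+8 ≤ L`, for every cyclically separated family of cubes there
are finitely many measurable CARRIER FIELDS `ψ_π` of the lattice configuration, bounded by `K`, and coefficients
`c_{iπ} ≥ 0` with (i) domination `I_i(lift U) ≤ Σ_π c_{iπ} ψ_π(lift U)`, (ii) `Σ_i c_{iπ} ≤ Λ`, (iii) `Σ_π c_{iπ} ≤ W`,
(iv) `⟨exp(Σ_π t_π ψ_π∘lift)⟩_{2L+1,β} ≤ exp(c_V Σ_π t_π)` for all `0 ≤ t ≤ a₀`.  THEN `Good := {I < θ}` satisfies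
hypothesis (b) of `DefectCollar.momentBounds6_of_goodLaw_and_rarity`.  (Read `ψ_π = β(1 − Re tr Ū^k(∂p))` over the
block plaquettes of all levels near the cubes: N20's (SF), asked of the Wilson state on the ODD torus.) [folklore] -/
theorem rarity_of_scaleFactorised {C₂ β₁ ℓ₁ : ℝ}
    (I : ℝ → ℕ → Fin 4 × Fin 4 → (Fin 4 → ℤ) → LGConfig 4 G → ℝ) (θ lam Λ W a₀ cV : ℝ → ℕ → ℝ)
    (hIm : ∀ β R q x, Measurable (I β R q x)) (hlam : ∀ β R, 0 ≤ lam β R)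
    (hlamΛ : ∀ β R, lam β R * Λ β R ≤ a₀ β R) (hcV : ∀ β R, 0 ≤ cV β R)
    (hnum : ∀ β : ℝ, β₁ ≤ β → ∀ R : ℕ, 1 ≤ R → (R : ℝ) * a β ≤ ℓ₁ →
      Real.exp (cV β R * lam β R * W β R - lam β R * θ β R) ≤ C₂ / (R : ℝ) ^ 4)
    (hSF : ∀ β : ℝ, β₁ ≤ β → ∀ (L n : ℕ) (q : Fin n → Fin 4 × Fin 4) (x : Fin n → (Fin 4 → ℤ)) (R : ℕ),
      (∀ i, (q i).1 < (q i).2) → 1 ≤ R → (R : ℝ) * a β ≤ ℓ₁ → 4 * R + 8 ≤ L →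
      (∀ i j : Fin n, i ≠ j → ∃ k : Fin 4,
        (2 * (R : ℤ) + 4) ≤ |((((x i k - x j k : ℤ) : ZMod (2 * L + 1))).valMinAbs : ℤ)|) →
      ∃ (κ : Type) (P : Finset κ) (ψ : κ → LGConfig 4 G → ℝ) (K : ℝ) (c : Fin n → κ → ℝ),
        (∀ π, Measurable (ψ π)) ∧ (∀ π η, |ψ π η| ≤ K) ∧ (∀ i, ∀ π ∈ P, 0 ≤ c i π) ∧
        (∀ (i : Fin n) (U : GaugeConfig 4 (2 * L + 1) G),
          I β R (q i) (x i) (torusLift (2 * L + 1) U) ≤ ∑ π ∈ P, c i π * ψ π (torusLift (2 * L + 1) U)) ∧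
        (∀ π ∈ P, ∑ i, c i π ≤ Λ β R) ∧ (∀ i, ∑ π ∈ P, c i π ≤ W β R) ∧
        (∀ t : κ → ℝ, (∀ π ∈ P, 0 ≤ t π ∧ t π ≤ a₀ β R) →
          torusE G r β L (fun U => Real.exp (∑ π ∈ P, t π * ψ π U)) ≤ Real.exp (cV β R * ∑ π ∈ P, t π))) :
    ∀ β : ℝ, β₁ ≤ β → ∀ (L n : ℕ) (q : Fin n → Fin 4 × Fin 4) (x : Fin n → (Fin 4 → ℤ)) (R : ℕ),
      (∀ i, (q i).1 < (q i).2) → 1 ≤ R → (R : ℝ) * a β ≤ ℓ₁ → 4 * R + 8 ≤ L →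
      (∀ i j : Fin n, i ≠ j → ∃ k : Fin 4,
        (2 * (R : ℤ) + 4) ≤ |((((x i k - x j k : ℤ) : ZMod (2 * L + 1))).valMinAbs : ℤ)|) →
      ∀ T : Finset (Fin n),
        torusE G r β L (fun U => ∏ i ∈ T,
          ({η | I β R (q i) (x i) η < θ β R})ᶜ.indicator (fun _ => (1 : ℝ)) U) ≤
          (C₂ / (R : ℝ) ^ 4) ^ T.card := by
  intro β hβ L n q x R hq hR hRa hRL hsep T
  haveI := isProbabilityMeasure_wilsonMeasure (d := 4) (L := 2 * L + 1) r.ρ r.continuous β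
  obtain ⟨κ, P, ψ, K, c, hψm, hψb, hc, hdom, hΛ, hW, hsf⟩ := hSF β hβ L n q x R hq hR hRa hRL hsep
  -- carriers and influences read on the torus
  set ψ' : κ → GaugeConfig 4 (2 * L + 1) G → ℝ := fun π U => ψ π (torusLift (2 * L + 1) U) with hψ'def
  have hψ'm : ∀ π, Measurable (ψ' π) := fun π => (hψm π).comp (measurable_torusLift _)
  have hψ'b : ∀ π U, |ψ' π U| ≤ K := fun π U => hψb π _
  set J : Fin n → GaugeConfig 4 (2 * L + 1) G → ℝ := fun i U => I β R (q i) (x i) (torusLift (2 * L + 1) U)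
    with hJdef
  have hJm : ∀ i, Measurable (J i) := fun i => (hIm β R (q i) (x i)).comp (measurable_torusLift _)
  have hind : ∀ U : GaugeConfig 4 (2 * L + 1) G,
      (∏ i ∈ T, ({η | I β R (q i) (x i) η < θ β R})ᶜ.indicator (fun _ => (1 : ℝ)) (torusLift (2 * L + 1) U)) =
        ∏ i ∈ T, {U | θ β R ≤ J i U}.indicator (fun _ => (1 : ℝ)) U := by
    intro U
    refine Finset.prod_congr rfl fun i _ => ?_
    rw [compl_setOf_lt, ← indicator_one_preimage]
    rfl
  have hmeas : ∀ i, MeasurableSet {U | θ β R ≤ J i U} := fun i => measurableSet_le measurable_const (hJm i)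
  have hdom' : ∀ i ∈ T, {U | θ β R ≤ J i U} ⊆ {U | θ β R ≤ ∑ π ∈ P, c i π * ψ' π U} := by
    intro i _ U hU
    have h1 : θ β R ≤ J i U := hU
    exact h1.trans (hdom i U)
  have hsf' : ∀ t : κ → ℝ, (∀ π ∈ P, 0 ≤ t π ∧ t π ≤ a₀ β R) →
      ∫ U, Real.exp (∑ π ∈ P, t π * ψ' π U) ∂(wilsonMeasure (d := 4) (L := 2 * L + 1) r.ρ β) ≤
        Real.exp (cV β R * ∑ π ∈ P, t π) := fun t ht => hsf t ht
  have hc' : ∀ i ∈ T, ∀ π ∈ P, 0 ≤ c i π := fun i _ π hπ => hc i π hπ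
  have hΛ' : ∀ π ∈ P, ∑ i ∈ T, c i π ≤ Λ β R := fun π hπ =>
    (Finset.sum_le_univ_sum_of_nonneg fun i => hc i π hπ).trans (hΛ π hπ)
  have hW' : ∀ i ∈ T, ∑ π ∈ P, c i π ≤ W β R := fun i _ => hW i
  have key := measureReal_biInter_le_pow_of_scaleFactorised (wilsonMeasure (d := 4) (L := 2 * L + 1) r.ρ β) T P ψ'
    hψ'm hψ'b c hc' (θ β R) (hlam β R) (hlamΛ β R) (hcV β R) hΛ' hW' hsf'
  show ∫ U, (∏ i ∈ T, ({η | I β R (q i) (x i) η < θ β R})ᶜ.indicator (fun _ => (1 : ℝ))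
      (torusLift (2 * L + 1) U)) ∂(wilsonMeasure (d := 4) (L := 2 * L + 1) r.ρ β) ≤ (C₂ / (R : ℝ) ^ 4) ^ T.card
  simp_rw [hind]
  rw [integral_prod_indicator_eq_measureReal _ T _ hmeas]
  exact ((measureReal_biInter_le_of_subset_superlevel _ T _ _ (θ β R) hdom').trans key).trans
    (pow_le_pow_left₀ (Real.exp_nonneg _) (hnum β hβ R hR hRa) _)

/-- **`MomentBounds6 G r a` from a TEMPERED centre law plus a SCALE-FACTORISED moment bound (SF) of the Wilson state
on odd tori** — the N20-currency twin of `momentBounds6_of_temperedLaw_and_polymerLaw`: (a) the tempered centre law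
for exteriors of influence `< θ`; (SF) as in `rarity_of_scaleFactorised`; `exp(c_V λ W − λθ) ≤ C₂/R⁴`.  THEN the
registered all-odd-sides ceilings `MomentBounds6 G r a` with constant `2C₁ + 2(C_A + P₀)C₂`.  [folklore: Georgii (2011)
Thm. 4.17 for the DLR part; the (SF) input is of Bałaban's large-field kind, cf. N20 `…ByValueMultiscaleWall`] -/
theorem momentBounds6_of_temperedLaw_and_scaleFactorised {C₁ C₂ β₁ ℓ₁ P₀ : ℝ} {p : Fin 4 × Fin 4 → ℝ → ℝ}
    (I : ℝ → ℕ → Fin 4 × Fin 4 → (Fin 4 → ℤ) → LGConfig 4 G → ℝ) (θ lam Λ W a₀ cV : ℝ → ℕ → ℝ)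
    (hℓ₁ : 0 < ℓ₁) (hC₁ : 0 ≤ C₁) (hC₂ : 0 ≤ C₂) (hp : ∀ q β, |p q β| ≤ P₀)
    (hIm : ∀ β R q x, Measurable (I β R q x)) (hlam : ∀ β R, 0 ≤ lam β R)
    (hlamΛ : ∀ β R, lam β R * Λ β R ≤ a₀ β R) (hcV : ∀ β R, 0 ≤ cV β R)
    (hnum : ∀ β : ℝ, β₁ ≤ β → ∀ R : ℕ, 1 ≤ R → (R : ℝ) * a β ≤ ℓ₁ →
      Real.exp (cV β R * lam β R * W β R - lam β R * θ β R) ≤ C₂ / (R : ℝ) ^ 4)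
    (hlaw : ∀ β : ℝ, β₁ ≤ β → ∀ R : ℕ, 1 ≤ R → (R : ℝ) * a β ≤ ℓ₁ →
      ∀ (q : Fin 4 × Fin 4) (x : Fin 4 → ℤ), q.1 < q.2 → ∀ η : LGConfig 4 G, I β R q x η < θ β R →
        |kerE G r β (fun k => x k - (R + 1)) (2 * R + 3) η (plane G r q x) - p q β| ≤ C₁ / (R : ℝ) ^ 4)
    (hSF : ∀ β : ℝ, β₁ ≤ β → ∀ (L n : ℕ) (q : Fin n → Fin 4 × Fin 4) (x : Fin n → (Fin 4 → ℤ)) (R : ℕ),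
      (∀ i, (q i).1 < (q i).2) → 1 ≤ R → (R : ℝ) * a β ≤ ℓ₁ → 4 * R + 8 ≤ L →
      (∀ i j : Fin n, i ≠ j → ∃ k : Fin 4,
        (2 * (R : ℤ) + 4) ≤ |((((x i k - x j k : ℤ) : ZMod (2 * L + 1))).valMinAbs : ℤ)|) →
      ∃ (κ : Type) (P : Finset κ) (ψ : κ → LGConfig 4 G → ℝ) (K : ℝ) (c : Fin n → κ → ℝ),
        (∀ π, Measurable (ψ π)) ∧ (∀ π η, |ψ π η| ≤ K) ∧ (∀ i, ∀ π ∈ P, 0 ≤ c i π) ∧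
        (∀ (i : Fin n) (U : GaugeConfig 4 (2 * L + 1) G),
          I β R (q i) (x i) (torusLift (2 * L + 1) U) ≤ ∑ π ∈ P, c i π * ψ π (torusLift (2 * L + 1) U)) ∧
        (∀ π ∈ P, ∑ i, c i π ≤ Λ β R) ∧ (∀ i, ∑ π ∈ P, c i π ≤ W β R) ∧
        (∀ t : κ → ℝ, (∀ π ∈ P, 0 ≤ t π ∧ t π ≤ a₀ β R) →
          torusE G r β L (fun U => Real.exp (∑ π ∈ P, t π * ψ π U)) ≤ Real.exp (cV β R * ∑ π ∈ P, t π))) :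
    MomentBounds6 G r a :=
  momentBounds6_of_goodLaw_and_rarity r a (fun β R q x => {η | I β R q x η < θ β R}) hℓ₁ hC₁ hC₂ hp
    (fun β R q x => measurableSet_lt (hIm β R q x) measurable_const)
    (fun β hβ R hR hRa q x hq η hη => hlaw β hβ R hR hRa q x hq η hη)
    (rarity_of_scaleFactorised r a I θ lam Λ W a₀ cV hIm hlam hlamΛ hcV hnum hSF)

end Route

/-! ## §4 Calibration of the threshold -/

section Calibration

/-- **Threshold calibration.**  For `R ≥ 1`, `C₂ > 0`: if `B + 4 log R − log C₂ ≤ λθ` then `exp(B − λθ) ≤ C₂/R⁴` —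
the numeric side condition of `momentBounds6_of_temperedLaw_and_expMoment` / `…_polymerLaw` / `…_scaleFactorised`
(with `B = λ e^{λΛ} W` resp. `c_V λ W`).  Since the collar radius ranges up to `ℓ₁/a(β)`, at the unit of record this
asks a tempering threshold `θ ≍ β/(λ b₀)`: the influence functional must be measured in action units. [folklore] -/
theorem exp_sub_le_div_pow_four {B lam θ C₂ : ℝ} {R : ℕ} (hR : 1 ≤ R) (hC₂ : 0 < C₂)
    (hθ : B + 4 * Real.log R - Real.log C₂ ≤ lam * θ) :
    Real.exp (B - lam * θ) ≤ C₂ / (R : ℝ) ^ 4 := by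
  have hRpos : (0 : ℝ) < R := by exact_mod_cast (show 0 < R by omega)
  have h1 : B - lam * θ ≤ Real.log C₂ - 4 * Real.log R := by linarith
  calc Real.exp (B - lam * θ) ≤ Real.exp (Real.log C₂ - 4 * Real.log R) := Real.exp_le_exp.2 h1
    _ = C₂ / (R : ℝ) ^ 4 := by
        rw [Real.exp_sub, Real.exp_log hC₂, show (4 : ℝ) * Real.log R = ((4 : ℕ) : ℝ) * Real.log R by norm_num,
          Real.exp_nat_mul, Real.exp_log hRpos]

end Calibration

end Summit.QuantumFields.YangMills.Cruxes.UVSeamRec.PolymerRarity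

end
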